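import Summits.NavierStokesRegularity.NavierStokesRegularity.Theorems.FilamentSkeletonRssDefectColumnGateDefsR
import Mathlib
import Summits.NavierStokesRegularity.NavierStokesRegularity.Theorems.FilamentSkeletonRssDefectColumnGateClosingIVT
import Summits.NavierStokesRegularity.NavierStokesRegularity.Theorems.FilamentSkeletonRssDefectColumnGateParamContinuity

/-!
# Route `FilamentSkeletonRss` · ∀-crux `TransverseReduction1AR` (stmt-NavierStokesRegularity-23611) · line `defect_column_gate_1AR` →
# «A1R-acc» (reduction MODULO ACCRETION MODES over the core-area box; director-ns dss_120/122 KEEP-R4 branch): the LINE-SIDE VOCABULARY, v3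

Definitions only (never asserted), `--supports stmt-NavierStokesRegularity-23611 --as helper`; LEAD of 23611, lane ns-filament-21221-p1 g13.  Supersedes the
files-only DRAFT v2 (`Cruxes/TransverseReductionRJ/Lines/defect_column_gate_1AR_acc_DRAFT.lean`, 3e409639, namespace `…AccDraft`).  Aligned to tenure
g26's route-side kit v3/v4 (`TransverseReduction1ARaccDraft.sig` 85f2378e6097f7ce, `SkeletonBoxR.sig` 460b8c928573f50d, critic (k2) MET 23:18:20Z) with
ONE LEAD reconciliation point, **R7**: in the ∀-item's per-`(p, β)` block the regularity is `ContDiff ℝ 2 (U p β) ∧ ContDiff ℝ 1 (P p β)` (as in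
`AlmostConcl1AG`), NOT `C^∞` — smoothness is recovered by the GLUE at the selected zero `(p⋆, β⋆)`, where the equation is exact (`F = 0`), through the
landed ladder `Theorems.KelvinGate.Smoothing.contDiff_velocity_infty / contDiff_pressure_infty` (exactly as `lineGlue1AR` does today); asking `C^∞` at
every `(p, β)` would force the ∀-side to certify `C^∞` of the accretion modes `D_pj` (the `DefD` formula, removable singularity on the tangent line) and of
the rate column `Zr`, for no use.  Everything else is tenure's text: abstract rate window `β ∈ [−1, 1]` with output rate `αo p β` (R1), `Zr` free (R2/K2-2),
export law division-free `k₀ ≤ k ∧ Γ·|B − k·F⁰| ≤ Ce` with `k₀, Ce, Γ₁` bound BEFORE `Γ` (R3/K2-1), joint continuity of `(g, B)` only (R4), rate faces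
`g p (−1) < 0 < g p 1` as ∀-side OUTPUT (R5), `F⁰ = (3/2 − w′_pj(c_pj))·Aa_pj(c_pj) + 4` (D6), `D` = RJ's `DefD` (D7).

Contents.  §0 the p-FAMILY hypothesis block of the acc-crux (`BoxDefU1 … BoxDefD1`, `BoxClauses1R` = joint continuity clause + `Clauses1R` at every `p` of
the cube — character-identical to tenure's block after unfolding) and its conclusion block `BoxConclAcc`; `CutFormAcc` (to be certified `↔` the route decl
by `Iff.rfl` once tenure files it).  §1 the line's specs over the box: `areaDefect`, `FamilySpecAcc` (S1-acc output: `FamilySpec1AG` at every `p` with the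
residual split `r + g·Z + Σ_j G_j·D_j`, the exported affine law on `G`, a UNIFORM orientation of the rate defect, joint local continuity in `(p, β)`),
`DefectGateSpecAcc` (S2-acc output: right inverse bordered by `Z` AND the `N` modes, bound / linearity per `(p, β)`, tightness UNIFORM on the box,
local continuity in `(p, β)`).  §2 the stub statements `DefectFamilyAcc` (S1-acc), `DefectGateAcc` + `GateAssemblyLocAcc := WaistColumnGateLoc1A →
DefectGateAcc` (S2a-loc unchanged + S2b-acc), `DefectClosingAcc` (S3-acc: NO intermediate-value theorem inside — the Miranda selection lives in the
route-level glue, `Theorems/…AccretionBoxMiranda.lean` p678153).  HONEST FRAMING: bookkeeping for a HYPOTHETICAL filament-type rotating-self-similar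
blow-up route (MODEL rung, negative side); nothing here bears on Navier–Stokes regularity; no item is proved, refuted or filed by this file.
-/

set_option linter.dupNamespace false

noncomputable section

namespace Summit.NavierStokesRegularity.NavierStokesRegularity.Theorems.DefectColumnGate

open scoped BigOperators Topology Manifold Classical MeasureTheory ProbabilityTheory Matrix InnerProductSpace ComplexConjugate ContinuousMap ENNReal ContDiff
open Filter Set Function TopologicalSpace MeasureTheory
open Literature.NS
open Literature.Analysis.FluidPDE
open Summit.NavierStokesRegularity.NavierStokesRegularity.Theses.FilamentSkeletonRss
open Summit.NavierStokesRegularity.NavierStokesRegularity.Theorems.KelvinGate (lerayOp lerayLin XBound YBound LocClose)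

/-! ## 0. The acc-crux, cut at its arrows (p-families over the core-area box `{p : Fin N → ℝ | ∀ i, p i ∈ Icc 0 1}`) -/

/-- Defining hypothesis 1 over the box: `DefU1` at every `p`. -/
def BoxDefU1 (N : ℕ) (Γ : ℝ) (γ : (Fin N → ℝ) → Fin N → ℝ) (Aa : (Fin N → ℝ) → Fin N → ℝ → ℝ)
    (u : (Fin N → ℝ) → (Fin N → ℝ → EuclideanSpace ℝ (Fin 3)) → EuclideanSpace ℝ (Fin 3) → EuclideanSpace ℝ (Fin 3)) : Prop :=
  ∀ p, DefU1 N Γ (γ p) (Aa p) (u p)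

/-- Defining hypothesis 2 over the box: `DefV1` at every `p`. -/
def BoxDefV1 (N : ℕ) (α : (Fin N → ℝ) → ℝ) (X : (Fin N → ℝ) → Fin N → ℝ → EuclideanSpace ℝ (Fin 3))
    (u : (Fin N → ℝ) → (Fin N → ℝ → EuclideanSpace ℝ (Fin 3)) → EuclideanSpace ℝ (Fin 3) → EuclideanSpace ℝ (Fin 3))
    (v : (Fin N → ℝ) → EuclideanSpace ℝ (Fin 3) → EuclideanSpace ℝ (Fin 3)) : Prop :=
  ∀ p, DefV1 N (α p) (X p) (u p) (v p)

/-- Defining hypothesis 3 over the box: `DefA1` at every `p`. -/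
def BoxDefA1 (N : ℕ) (X : (Fin N → ℝ) → Fin N → ℝ → EuclideanSpace ℝ (Fin 3)) (c : (Fin N → ℝ) → Fin N → ℝ)
    (v : (Fin N → ℝ) → EuclideanSpace ℝ (Fin 3) → EuclideanSpace ℝ (Fin 3)) (A : (Fin N → ℝ) → Fin N → (EuclideanSpace ℝ (Fin 3) →L[ℝ] EuclideanSpace ℝ (Fin 3))) : Prop :=
  ∀ p, DefA1 N (X p) (c p) (v p) (A p)

/-- Defining hypothesis 4 over the box: `DefT1` at every `p`. -/
def BoxDefT1 (N : ℕ) (α : (Fin N → ℝ) → ℝ) (u : (Fin N → ℝ) → (Fin N → ℝ → EuclideanSpace ℝ (Fin 3)) → EuclideanSpace ℝ (Fin 3) → EuclideanSpace ℝ (Fin 3))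
    (T : (Fin N → ℝ) → (Fin N → ℝ → EuclideanSpace ℝ (Fin 3)) → Fin N → ℝ → EuclideanSpace ℝ (Fin 3)) : Prop :=
  ∀ p, DefT1 N (α p) (u p) (T p)

/-- Defining hypothesis 5 over the box (RJ's `DefD` text, D7): the ACCRETION MODE of tube `j` of the skeleton at `p` — Gaussian in the axial distance,
Lamb–Oseen in the distance to the waist tangent line, azimuthal about `X_pj′(c_pj)`. -/
def BoxDefD1 (N : ℕ) (X : (Fin N → ℝ) → Fin N → ℝ → EuclideanSpace ℝ (Fin 3)) (c : (Fin N → ℝ) → Fin N → ℝ)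
    (D : (Fin N → ℝ) → Fin N → EuclideanSpace ℝ (Fin 3) → EuclideanSpace ℝ (Fin 3)) : Prop :=
  ∀ p j y, D p j y = (Real.exp (-(⟪y-X p j (c p j), deriv (X p j) (c p j)⟫_ℝ)^2)*((1-Real.exp (-(‖y-X p j (c p j)‖^2-⟪y-X p j (c p j), deriv (X p j) (c p j)⟫_ℝ^2)))/(‖y-X p j (c p j)‖^2-⟪y-X p j (c p j), deriv (X p j) (c p j)⟫_ℝ^2)))•cross (deriv (X p j) (c p j)) (y-X p j (c p j))

/-- The hypothesis CLAUSE BLOCK of the acc-crux (= `SkeletonBoxR`'s block, tenure v2 460b8c92): joint continuity of the skeleton data in `(p, τ)` on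
`cube × ℝ` (tuple incl. the waist frames `m, n`), and `Clauses1R` (13-R tail) at EVERY `p` of the cube. -/
def BoxClauses1R (N : ℕ) (Γ δ ρ K Λ a b cnd Rw Rb cg θ₀ KA : ℝ) (γ : (Fin N → ℝ) → Fin N → ℝ) (α : (Fin N → ℝ) → ℝ)
    (X : (Fin N → ℝ) → Fin N → ℝ → EuclideanSpace ℝ (Fin 3)) (w : (Fin N → ℝ) → Fin N → ℝ → ℝ) (c : (Fin N → ℝ) → Fin N → ℝ)
    (m n : (Fin N → ℝ) → Fin N → EuclideanSpace ℝ (Fin 3)) (Aa : (Fin N → ℝ) → Fin N → ℝ → ℝ) (v : (Fin N → ℝ) → EuclideanSpace ℝ (Fin 3) → EuclideanSpace ℝ (Fin 3))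
    (A : (Fin N → ℝ) → Fin N → (EuclideanSpace ℝ (Fin 3) →L[ℝ] EuclideanSpace ℝ (Fin 3)))
    (T : (Fin N → ℝ) → (Fin N → ℝ → EuclideanSpace ℝ (Fin 3)) → Fin N → ℝ → EuclideanSpace ℝ (Fin 3)) : Prop :=
  (∀ j, ContinuousOn (fun q:(Fin N→ℝ) × ℝ => (α q.1, γ q.1 j, c q.1 j, X q.1 j q.2, w q.1 j q.2, Aa q.1 j q.2, m q.1 j, n q.1 j)) ({p:Fin N → ℝ | ∀ i, p i ∈ Icc 0 1} ×ˢ univ)) ∧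
  (∀ p:Fin N → ℝ, (∀ i, p i ∈ Icc 0 1) → Clauses1R N Γ δ ρ K Λ a b cnd Rw Rb cg θ₀ KA (γ p) (α p) (X p) (w p) (c p) (m p) (n p) (Aa p) (v p) (A p) (T p))

/-- The UNPAID PASSIVE AREA LAW of a rigid core of area `A` at a waist with axial strain `w′(c)`: `F⁰(A) = (3/2 − w′(c))·A + 4` (D6: the route's area-law conjunct
`w·Aa′ = (3/2 − w′)·Aa + 4` of `Clauses1G`, at the waist `w = 0`).  Slope `≤ −δ` under the waist clause; zero at the matched area `A* = 4/(w′(c) − 3/2)`. -/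
def areaDefect (wc A : ℝ) : ℝ := (3 / 2 - wc) * A + 4

/-- The CONCLUSION BLOCK of the acc-crux for candidate outputs `(C₀, M, αo, g, B, k, Zr, U, P)` over the box times the abstract rate window `[−1, 1]` (tenure v3
text with R7: `C²/C¹` regularity per `(p, β)`): joint continuity of `(g, B)`; rate faces; at every `(p, β)` the profile equation at rate `αo p β ≠ 0` MODULO the rate
mode `Zr` and the `N` accretion modes `D_pj`, with Type-I / pressure / waist envelopes, and the EXPORTED affine area law `k₀ ≤ k ∧ Γ·|B − k·F⁰| ≤ Ce`. -/
def BoxConclAcc (N : ℕ) (Γ ρ η Rw k₀ Ce : ℝ) (X : (Fin N → ℝ) → Fin N → ℝ → EuclideanSpace ℝ (Fin 3)) (w : (Fin N → ℝ) → Fin N → ℝ → ℝ) (c : (Fin N → ℝ) → Fin N → ℝ)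
    (Aa : (Fin N → ℝ) → Fin N → ℝ → ℝ) (u : (Fin N → ℝ) → (Fin N → ℝ → EuclideanSpace ℝ (Fin 3)) → EuclideanSpace ℝ (Fin 3) → EuclideanSpace ℝ (Fin 3))
    (D : (Fin N → ℝ) → Fin N → EuclideanSpace ℝ (Fin 3) → EuclideanSpace ℝ (Fin 3)) (C₀ M : ℝ) (αo g : (Fin N → ℝ) → ℝ → ℝ) (B k : (Fin N → ℝ) → ℝ → Fin N → ℝ)
    (Zr U : (Fin N → ℝ) → ℝ → EuclideanSpace ℝ (Fin 3) → EuclideanSpace ℝ (Fin 3)) (P : (Fin N → ℝ) → ℝ → EuclideanSpace ℝ (Fin 3) → ℝ) : Prop :=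
  ContinuousOn (fun q:(Fin N→ℝ) × ℝ => (g q.1 q.2, B q.1 q.2)) ({p:Fin N → ℝ | ∀ i, p i ∈ Icc 0 1} ×ˢ Icc (-1) 1) ∧
  (∀ p:Fin N → ℝ, (∀ i, p i ∈ Icc 0 1) → g p (-1) < 0 ∧ 0 < g p 1) ∧
  (∀ (p:Fin N → ℝ) (β:ℝ), (∀ i, p i ∈ Icc 0 1) → β ∈ Icc (-1) 1 → αo p β ≠ 0 ∧ U p β ≠ 0 ∧ ContDiff ℝ 2 (U p β) ∧ ContDiff ℝ 1 (P p β) ∧ VectorCalculus.IsDivFree (U p β)∧(∀ y, αo p β•(cross (EuclideanSpace.single 2 1) (U p β y)-fderiv ℝ (U p β) y (cross (EuclideanSpace.single 2 1) y))+(1/2:ℝ)•U p β y+(1/2:ℝ)•fderiv ℝ (U p β) y y-(Laplacian.laplacian (U p β)) y+fderiv ℝ (U p β) y (U p β y)+gradient (P p β) y = g p β•Zr p β y+∑ j, B p β j•D p j y)∧(∀ y, ‖U p β y‖≤C₀/(1+‖y‖))∧(∀ y, |P p β y|≤M)∧(∀ y, ‖y‖≤Rw*√Γ → (∀ j τ,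 ρ*√Γ/4≤‖y-X p j τ‖) → ‖U p β y-u p (X p) y‖≤η*√Γ)∧(∀ j, k₀≤k p β j ∧ Γ*|B p β j-k p β j*areaDefect (deriv (w p j) (c p j)) (Aa p j (c p j))|≤Ce))

/-- The CUT FORM of the acc-crux `TransverseReduction1ARacc` (tenure draft v3 + R7): for all box constants there are EXPORT constants `k₀ > 0, Ce` and a threshold
`Γ₁` (uniform: bound before `Γ` and the family, K2-1) such that every admissible p-family of clause-13-R skeleta carries outputs satisfying `BoxConclAcc`.
To be certified `TransverseReduction1ARacc ↔ CutFormAcc := Iff.rfl` when the item is filed. -/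
abbrev CutFormAcc : Prop :=
  ∀ (N : ℕ) (δ ρ K Λ a b cnd η Rw Rb cg θ₀ KA : ℝ), 0 < N → 0 < δ → 0 < ρ → 0 ≤ a → 0 < η → 0 < Rw → 0 < Rb → 0 < cg → 0 < θ₀ →
    ∃ (k₀ Ce Γ₁ : ℝ), 0 < k₀ ∧ ∀ Γ : ℝ, Γ₁ ≤ Γ →
    ∀ (γ : (Fin N → ℝ) → Fin N → ℝ) (α : (Fin N → ℝ) → ℝ) (X : (Fin N → ℝ) → Fin N → ℝ → EuclideanSpace ℝ (Fin 3)) (w : (Fin N → ℝ) → Fin N → ℝ → ℝ)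
      (c : (Fin N → ℝ) → Fin N → ℝ) (m n : (Fin N → ℝ) → Fin N → EuclideanSpace ℝ (Fin 3)) (Aa : (Fin N → ℝ) → Fin N → ℝ → ℝ)
      (u : (Fin N → ℝ) → (Fin N → ℝ → EuclideanSpace ℝ (Fin 3)) → EuclideanSpace ℝ (Fin 3) → EuclideanSpace ℝ (Fin 3))
      (v : (Fin N → ℝ) → EuclideanSpace ℝ (Fin 3) → EuclideanSpace ℝ (Fin 3)) (A : (Fin N → ℝ) → Fin N → (EuclideanSpace ℝ (Fin 3) →L[ℝ] EuclideanSpace ℝ (Fin 3)))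
      (T : (Fin N → ℝ) → (Fin N → ℝ → EuclideanSpace ℝ (Fin 3)) → Fin N → ℝ → EuclideanSpace ℝ (Fin 3))
      (D : (Fin N → ℝ) → Fin N → EuclideanSpace ℝ (Fin 3) → EuclideanSpace ℝ (Fin 3)),
      BoxDefU1 N Γ γ Aa u → BoxDefV1 N α X u v → BoxDefA1 N X c v A → BoxDefT1 N α u T → BoxDefD1 N X c D →
      BoxClauses1R N Γ δ ρ K Λ a b cnd Rw Rb cg θ₀ KA γ α X w c m n Aa v A T →
      ∃ (C₀ M : ℝ) (αo g : (Fin N → ℝ) → ℝ → ℝ) (B k : (Fin N → ℝ) → ℝ → Fin N → ℝ) (Zr U : (Fin N → ℝ) → ℝ → EuclideanSpace ℝ (Fin 3) → EuclideanSpace ℝ (Fin 3))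
        (P : (Fin N → ℝ) → ℝ → EuclideanSpace ℝ (Fin 3) → ℝ), BoxConclAcc N Γ ρ η Rw k₀ Ce X w c Aa u D C₀ M αo g B k Zr U P

/-! ## 1. The specs of the line over the box -/

/-- **Spec of S1-acc · RE-WOUND DEFECT FAMILY of order `k` OVER THE BOX, residual split modulo the `N + 1` modes.**  For every `p` in the cube: `FamilySpec1AG`'s
clauses at the skeleton `p` (base rate `α⁰_p`, physical window `|β| ≤ β₀` with `0 < β₀ ≤ min(θ₀/4, 2Γ^(−q₁))` UNIFORM in `p`, smooth divergence-free `U⁰_{p,β}`,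
size `Cs·Γ⁴`, non-degenerate, waist-close, compactly supported rate column `Z_{p,β} = 𝓡U⁰_{p,β}` in the doubled ball), EXCEPT that the profile equation at rate
`α⁰_p + β` holds up to `r + g·Z + Σ_j G_j·D_pj` with `Y(r) ≤ C_r·Γ^(−k)`, `|g| ≤ Cs·Γ^(−q₁)`, and accretion coefficients obeying the EXPORTED affine area law
`k₀ ≤ kA ∧ Γ·|G_j − kA_j·F⁰_pj| ≤ Cs` (R3; `F⁰_pj = areaDefect (w′_pj(c_pj)) (Aa_pj(c_pj))`); the rate defect has ONE orientation on the whole box with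
margin `Γ^(−q₁)` at `β = ∓β₀`; and `(U⁰, Z, r, g, G)` are locally continuous in `(p, β)` jointly (sup on balls for the fields). -/
def FamilySpecAcc (N : ℕ) (Γ ρ η Rw Rb θ₀ k₀ : ℝ) (k : ℕ) (Cs Cr q₁ : ℝ)
    (α : (Fin N → ℝ) → ℝ) (X : (Fin N → ℝ) → Fin N → ℝ → EuclideanSpace ℝ (Fin 3)) (w : (Fin N → ℝ) → Fin N → ℝ → ℝ) (c : (Fin N → ℝ) → Fin N → ℝ)
    (Aa : (Fin N → ℝ) → Fin N → ℝ → ℝ) (u : (Fin N → ℝ) → (Fin N → ℝ → EuclideanSpace ℝ (Fin 3)) → EuclideanSpace ℝ (Fin 3) → EuclideanSpace ℝ (Fin 3))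
    (D : (Fin N → ℝ) → Fin N → EuclideanSpace ℝ (Fin 3) → EuclideanSpace ℝ (Fin 3))
    (α0 : (Fin N → ℝ) → ℝ) (β₀ : ℝ) (U0 : (Fin N → ℝ) → ℝ → EuclideanSpace ℝ (Fin 3) → EuclideanSpace ℝ (Fin 3)) (P0 : (Fin N → ℝ) → ℝ → EuclideanSpace ℝ (Fin 3) → ℝ)
    (Z : (Fin N → ℝ) → ℝ → EuclideanSpace ℝ (Fin 3) → EuclideanSpace ℝ (Fin 3)) (g : (Fin N → ℝ) → ℝ → ℝ) (G kA : (Fin N → ℝ) → ℝ → Fin N → ℝ)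
    (r : (Fin N → ℝ) → ℝ → EuclideanSpace ℝ (Fin 3) → EuclideanSpace ℝ (Fin 3)) : Prop :=
  0 < β₀ ∧ β₀ ≤ θ₀ / 4 ∧ β₀ ≤ 2 * Γ ^ (-q₁) ∧
  ((∀ p : Fin N → ℝ, (∀ i, p i ∈ Icc (0:ℝ) 1) → g p (-β₀) ≤ -Γ ^ (-q₁) ∧ Γ ^ (-q₁) ≤ g p β₀) ∨
    (∀ p : Fin N → ℝ, (∀ i, p i ∈ Icc (0:ℝ) 1) → g p β₀ ≤ -Γ ^ (-q₁) ∧ Γ ^ (-q₁) ≤ g p (-β₀))) ∧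
  ∀ p : Fin N → ℝ, (∀ i, p i ∈ Icc (0:ℝ) 1) →
    |α0 p - α p| ≤ θ₀ / 4 ∧
    (∀ β : ℝ, |β| ≤ β₀ →
      ContDiff ℝ (⊤:ℕ∞) (U0 p β) ∧ ContDiff ℝ (⊤:ℕ∞) (P0 p β) ∧ VectorCalculus.IsDivFree (U0 p β) ∧
      XBound (U0 p β) (Cs * Γ ^ 4) ∧ (∀ y, |P0 p β y| ≤ Cs * Γ ^ 4) ∧ (∃ y₀, ‖y₀‖ ≤ Cs ∧ 1 ≤ ‖U0 p β y₀‖) ∧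
      (∀ y, ‖y‖ ≤ Rw * √Γ → (∀ j τ, ρ * √Γ / 4 ≤ ‖y - X p j τ‖) → ‖U0 p β y - u p (X p) y‖ ≤ η * √Γ / 2) ∧
      YBound (Z p β) (Cs * Γ ^ 6) ∧ (∀ y, ‖y‖ ≤ 2 * Rb * √(Γ * Real.log Γ) → Z p β y = rateGen (U0 p β) y) ∧
      (∀ y, 4 * Rb * √(Γ * Real.log Γ) ≤ ‖y‖ → Z p β y = 0) ∧
      YBound (r p β) (Cr * Γ ^ (-(k:ℝ))) ∧ |g p β| ≤ Cs * Γ ^ (-q₁) ∧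
      (∀ j, k₀ ≤ kA p β j ∧ Γ * |G p β j - kA p β j * areaDefect (deriv (w p j) (c p j)) (Aa p j (c p j))| ≤ Cs) ∧
      (∀ y, lerayOp (α0 p + β) (U0 p β) y + gradient (P0 p β) y = r p β y + g p β • Z p β y + ∑ j, G p β j • D p j y)) ∧
    (∀ β : ℝ, |β| ≤ β₀ → ∀ L ε : ℝ, 0 < ε → ∃ δ' : ℝ, 0 < δ' ∧ ∀ p' : Fin N → ℝ, (∀ i, p' i ∈ Icc (0:ℝ) 1) → ∀ β' : ℝ, |β'| ≤ β₀ →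
      dist p' p < δ' → |β' - β| < δ' →
      LocClose (U0 p' β') (U0 p β) L ε ∧ LocClose (Z p' β') (Z p β) L ε ∧ (∀ y, ‖y‖ ≤ L → ‖r p' β' y - r p β y‖ ≤ ε) ∧
        |g p' β' - g p β| ≤ ε ∧ ∀ j, |G p' β' j - G p β j| ≤ ε)

/-- **Spec of S2-acc · GATE BORDERED BY THE RATE COLUMN AND THE `N` ACCRETION MODES, over the box.**  At every `(p, β)`: a RIGHT INVERSE
`F ↦ (𝓚F, 𝓠F, 𝓫F, 𝓬F)` of the linearised profile operator at `(α⁰_p + β, U⁰_{p,β})` bordered on the range side by `Z_{p,β}` and `D_{p,1…N}`: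
`𝓛(𝓚F) + ∇(𝓠F) + (𝓫F)·Z + Σ_j (𝓬F)_j·D_pj = F`, `div 𝓚F = 0`, all outputs `≤ C₂Γ^κ·Y(F)` (1), linear in `F` (2); TIGHT uniformly on the box (3); locally continuous in
`(p, β)` at fixed data (4).  By R4's count the `N + 1` borders span the near-cokernel, so (1) on ALL of `Y` is the honest expectation here. -/
def DefectGateSpecAcc (N : ℕ) (Γ κ C₂ β₀ : ℝ) (α0 : (Fin N → ℝ) → ℝ) (U0 : (Fin N → ℝ) → ℝ → EuclideanSpace ℝ (Fin 3) → EuclideanSpace ℝ (Fin 3))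
    (Z : (Fin N → ℝ) → ℝ → EuclideanSpace ℝ (Fin 3) → EuclideanSpace ℝ (Fin 3)) (D : (Fin N → ℝ) → Fin N → EuclideanSpace ℝ (Fin 3) → EuclideanSpace ℝ (Fin 3))
    (𝓚 : (Fin N → ℝ) → ℝ → (EuclideanSpace ℝ (Fin 3) → EuclideanSpace ℝ (Fin 3)) → EuclideanSpace ℝ (Fin 3) → EuclideanSpace ℝ (Fin 3))
    (𝓠 : (Fin N → ℝ) → ℝ → (EuclideanSpace ℝ (Fin 3) → EuclideanSpace ℝ (Fin 3)) → EuclideanSpace ℝ (Fin 3) → ℝ)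
    (𝓫 : (Fin N → ℝ) → ℝ → (EuclideanSpace ℝ (Fin 3) → EuclideanSpace ℝ (Fin 3)) → ℝ)
    (𝓬 : (Fin N → ℝ) → ℝ → (EuclideanSpace ℝ (Fin 3) → EuclideanSpace ℝ (Fin 3)) → Fin N → ℝ) : Prop :=
  (∀ p : Fin N → ℝ, (∀ i, p i ∈ Icc (0:ℝ) 1) → ∀ β : ℝ, |β| ≤ β₀ →
    (∀ (F : EuclideanSpace ℝ (Fin 3) → EuclideanSpace ℝ (Fin 3)) (R : ℝ), YBound F R →
        XBound (𝓚 p β F) (C₂ * Γ ^ κ * R) ∧ ContDiff ℝ 1 (𝓠 p β F) ∧ (∀ y, |𝓠 p β F y| ≤ C₂ * Γ ^ κ * R) ∧ |𝓫 p β F| ≤ C₂ * Γ ^ κ * R ∧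
        (∀ j, |𝓬 p β F j| ≤ C₂ * Γ ^ κ * R) ∧ VectorCalculus.IsDivFree (𝓚 p β F) ∧
        ∀ y, lerayLin (α0 p + β) (U0 p β) (𝓚 p β F) y + gradient (𝓠 p β F) y + 𝓫 p β F • Z p β y + ∑ j, 𝓬 p β F j • D p j y = F y) ∧
    (∀ (F H : EuclideanSpace ℝ (Fin 3) → EuclideanSpace ℝ (Fin 3)) (s : ℝ), (∃ R, YBound F R) → (∃ R, YBound H R) →
        (𝓚 p β (fun y => F y + s • H y) = fun y => 𝓚 p β F y + s • 𝓚 p β H y) ∧ 𝓫 p β (fun y => F y + s • H y) = 𝓫 p β F + s * 𝓫 p β H ∧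
        ∀ j, 𝓬 p β (fun y => F y + s • H y) j = 𝓬 p β F j + s * 𝓬 p β H j)) ∧
  (∀ R L ε : ℝ, 0 < ε → ∃ L' δ₀ : ℝ, 0 < δ₀ ∧ ∀ p : Fin N → ℝ, (∀ i, p i ∈ Icc (0:ℝ) 1) → ∀ β : ℝ, |β| ≤ β₀ →
      ∀ F : EuclideanSpace ℝ (Fin 3) → EuclideanSpace ℝ (Fin 3), YBound F R → (∀ y, ‖y‖ ≤ L' → ‖F y‖ ≤ δ₀) →
        (∀ y, ‖y‖ ≤ L → ‖𝓚 p β F y‖ ≤ ε ∧ ‖fderiv ℝ (𝓚 p β F) y‖ ≤ ε) ∧ |𝓫 p β F| ≤ ε ∧ ∀ j, |𝓬 p β F j| ≤ ε) ∧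
  (∀ p : Fin N → ℝ, (∀ i, p i ∈ Icc (0:ℝ) 1) → ∀ β : ℝ, |β| ≤ β₀ → ∀ (F : EuclideanSpace ℝ (Fin 3) → EuclideanSpace ℝ (Fin 3)) (R L ε : ℝ),
      YBound F R → 0 < ε → ∃ δ' : ℝ, 0 < δ' ∧ ∀ p' : Fin N → ℝ, (∀ i, p' i ∈ Icc (0:ℝ) 1) → ∀ β' : ℝ, |β'| ≤ β₀ → dist p' p < δ' → |β' - β| < δ' →
        LocClose (𝓚 p' β' F) (𝓚 p β F) L ε ∧ |𝓫 p' β' F - 𝓫 p β F| ≤ ε ∧ ∀ j, |𝓬 p' β' F j - 𝓬 p β F j| ≤ ε)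

/-! ## 2. The statements of the acc-line (S2a-loc `WaistColumnGateLoc1A` is reused unchanged, clause-free) -/

/-- **Statement of stub S1-acc · `DefectFamilyAcc`** (size XL): existence of the re-wound defect family over the box, with a size constant `Cs` and an export gain
`k₀ > 0` uniform in the requested window exponent `q₁` and order `k` (the residual constant `C_r` and the threshold `Γ₁` may depend on them). -/
def DefectFamilyAcc : Prop :=
  ∀ (N : ℕ) (δ ρ K Λ a b cnd η Rw Rb cg θ₀ KA : ℝ), 0 < N → 0 < δ → 0 < ρ → 0 ≤ a → 0 < η → 0 < Rw → 0 < Rb → 0 < cg → 0 < θ₀ →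
    ∃ Cs k₀ : ℝ, 0 < k₀ ∧ ∀ (q₁ : ℝ) (k : ℕ), ∃ Cr Γ₁ : ℝ, ∀ Γ : ℝ, Γ₁ ≤ Γ →
    ∀ (γ : (Fin N → ℝ) → Fin N → ℝ) (α : (Fin N → ℝ) → ℝ) (X : (Fin N → ℝ) → Fin N → ℝ → EuclideanSpace ℝ (Fin 3)) (w : (Fin N → ℝ) → Fin N → ℝ → ℝ)
      (c : (Fin N → ℝ) → Fin N → ℝ) (m n : (Fin N → ℝ) → Fin N → EuclideanSpace ℝ (Fin 3)) (Aa : (Fin N → ℝ) → Fin N → ℝ → ℝ)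
      (u : (Fin N → ℝ) → (Fin N → ℝ → EuclideanSpace ℝ (Fin 3)) → EuclideanSpace ℝ (Fin 3) → EuclideanSpace ℝ (Fin 3))
      (v : (Fin N → ℝ) → EuclideanSpace ℝ (Fin 3) → EuclideanSpace ℝ (Fin 3)) (A : (Fin N → ℝ) → Fin N → (EuclideanSpace ℝ (Fin 3) →L[ℝ] EuclideanSpace ℝ (Fin 3)))
      (T : (Fin N → ℝ) → (Fin N → ℝ → EuclideanSpace ℝ (Fin 3)) → Fin N → ℝ → EuclideanSpace ℝ (Fin 3))
      (D : (Fin N → ℝ) → Fin N → EuclideanSpace ℝ (Fin 3) → EuclideanSpace ℝ (Fin 3)),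
      BoxDefU1 N Γ γ Aa u → BoxDefV1 N α X u v → BoxDefA1 N X c v A → BoxDefT1 N α u T → BoxDefD1 N X c D →
      BoxClauses1R N Γ δ ρ K Λ a b cnd Rw Rb cg θ₀ KA γ α X w c m n Aa v A T →
      ∃ (α0 : (Fin N → ℝ) → ℝ) (β₀ : ℝ) (U0 : (Fin N → ℝ) → ℝ → EuclideanSpace ℝ (Fin 3) → EuclideanSpace ℝ (Fin 3)) (P0 : (Fin N → ℝ) → ℝ → EuclideanSpace ℝ (Fin 3) → ℝ)
        (Z : (Fin N → ℝ) → ℝ → EuclideanSpace ℝ (Fin 3) → EuclideanSpace ℝ (Fin 3)) (g : (Fin N → ℝ) → ℝ → ℝ) (G kA : (Fin N → ℝ) → ℝ → Fin N → ℝ)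
        (r : (Fin N → ℝ) → ℝ → EuclideanSpace ℝ (Fin 3) → EuclideanSpace ℝ (Fin 3)),
        FamilySpecAcc N Γ ρ η Rw Rb θ₀ k₀ k Cs Cr q₁ α X w c Aa u D α0 β₀ U0 P0 Z g G kA r

/-- **Conclusion of stub S2b-acc · `DefectGateAcc`**: around EVERY defect family over the box with window exponent `q₁ ≥ q₀` and order `k ≥ k₀'` there is a gate
bordered by the rate column and the `N` modes (spec `DefectGateSpecAcc`), with exponent `κ` and constant `C₂` depending on the box constants, `Cs` and `k₀` only. -/
def DefectGateAcc : Prop :=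
  ∀ (N : ℕ) (δ ρ K Λ a b cnd η Rw Rb cg θ₀ KA : ℝ), 0 < N → 0 < δ → 0 < ρ → 0 ≤ a → 0 < η → 0 < Rw → 0 < Rb → 0 < cg → 0 < θ₀ →
    ∀ Cs k₀ : ℝ, ∃ κ C₂ q₀ : ℝ, ∃ k₀' : ℕ, ∀ q₁ : ℝ, q₀ ≤ q₁ → ∀ k : ℕ, k₀' ≤ k → 1 ≤ k → ∀ Cr : ℝ, ∃ Γ₁ : ℝ, ∀ Γ : ℝ, Γ₁ ≤ Γ →
    ∀ (γ : (Fin N → ℝ) → Fin N → ℝ) (α : (Fin N → ℝ) → ℝ) (X : (Fin N → ℝ) → Fin N → ℝ → EuclideanSpace ℝ (Fin 3)) (w : (Fin N → ℝ) → Fin N → ℝ → ℝ)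
      (c : (Fin N → ℝ) → Fin N → ℝ) (m n : (Fin N → ℝ) → Fin N → EuclideanSpace ℝ (Fin 3)) (Aa : (Fin N → ℝ) → Fin N → ℝ → ℝ)
      (u : (Fin N → ℝ) → (Fin N → ℝ → EuclideanSpace ℝ (Fin 3)) → EuclideanSpace ℝ (Fin 3) → EuclideanSpace ℝ (Fin 3))
      (v : (Fin N → ℝ) → EuclideanSpace ℝ (Fin 3) → EuclideanSpace ℝ (Fin 3)) (A : (Fin N → ℝ) → Fin N → (EuclideanSpace ℝ (Fin 3) →L[ℝ] EuclideanSpace ℝ (Fin 3)))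
      (T : (Fin N → ℝ) → (Fin N → ℝ → EuclideanSpace ℝ (Fin 3)) → Fin N → ℝ → EuclideanSpace ℝ (Fin 3))
      (D : (Fin N → ℝ) → Fin N → EuclideanSpace ℝ (Fin 3) → EuclideanSpace ℝ (Fin 3)),
      BoxDefU1 N Γ γ Aa u → BoxDefV1 N α X u v → BoxDefA1 N X c v A → BoxDefT1 N α u T → BoxDefD1 N X c D →
      BoxClauses1R N Γ δ ρ K Λ a b cnd Rw Rb cg θ₀ KA γ α X w c m n Aa v A T →
      ∀ (α0 : (Fin N → ℝ) → ℝ) (β₀ : ℝ) (U0 : (Fin N → ℝ) → ℝ → EuclideanSpace ℝ (Fin 3) → EuclideanSpace ℝ (Fin 3)) (P0 : (Fin N → ℝ) → ℝ → EuclideanSpace ℝ (Fin 3) → ℝ)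
        (Z : (Fin N → ℝ) → ℝ → EuclideanSpace ℝ (Fin 3) → EuclideanSpace ℝ (Fin 3)) (g : (Fin N → ℝ) → ℝ → ℝ) (G kA : (Fin N → ℝ) → ℝ → Fin N → ℝ)
        (r : (Fin N → ℝ) → ℝ → EuclideanSpace ℝ (Fin 3) → EuclideanSpace ℝ (Fin 3)),
        FamilySpecAcc N Γ ρ η Rw Rb θ₀ k₀ k Cs Cr q₁ α X w c Aa u D α0 β₀ U0 P0 Z g G kA r →
      ∃ (𝓚 : (Fin N → ℝ) → ℝ → (EuclideanSpace ℝ (Fin 3) → EuclideanSpace ℝ (Fin 3)) → EuclideanSpace ℝ (Fin 3) → EuclideanSpace ℝ (Fin 3))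
        (𝓠 : (Fin N → ℝ) → ℝ → (EuclideanSpace ℝ (Fin 3) → EuclideanSpace ℝ (Fin 3)) → EuclideanSpace ℝ (Fin 3) → ℝ)
        (𝓫 : (Fin N → ℝ) → ℝ → (EuclideanSpace ℝ (Fin 3) → EuclideanSpace ℝ (Fin 3)) → ℝ)
        (𝓬 : (Fin N → ℝ) → ℝ → (EuclideanSpace ℝ (Fin 3) → EuclideanSpace ℝ (Fin 3)) → Fin N → ℝ),
        DefectGateSpecAcc N Γ κ C₂ β₀ α0 U0 Z D 𝓚 𝓠 𝓫 𝓬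

/-- **Statement of stub S2b-acc · `GateAssemblyLocAcc`**: patching the LOCALISED sectional gate (S2a-loc `WaistColumnGateLoc1A`, clause-free, unchanged since v4)
into the gate bordered by the rate column AND the `N` waist-accretion modes (R4: these span the near-cokernel the v5/v6a one-border gate was blind to). -/
def GateAssemblyLocAcc : Prop :=
  WaistColumnGateLoc1A → DefectGateAcc

/-- **Statement of stub S3-acc · `DefectClosingAcc`** (size L; frozen contraction at each `(p, β)` + JOINT CONTINUITY of the `N + 1` multipliers + export transfer;
NO intermediate-value theorem — the Miranda selection is the route-level glue).  Given `Cs`, `k₀ > 0`, the gate's `κ, C₂` and ANY thresholds `q₀, k₀'`, SOME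
`q₁ ≥ q₀` and `k ≥ k₀'` suffice: for every family of that order over the box and every bordered gate around it, for `Γ ≥ Γ₁`, the outputs
`αo := α⁰_p + β₀b`, `U := U⁰ + 𝓚G`, `P := P⁰ + 𝓠G`, `(g', B) := ±(g − 𝓫G, ·), (G_j − 𝓬_jG)_j`, `Zr := ±Z` (sign = the family's orientation), `k := kA`
satisfy `BoxConclAcc` with export constants `(k₀, Cs + 1)`, where `G_{p,β}` is the Picard fixed point `G = −r − D(𝓚G)[𝓚G]` in the `2C_rΓ^(−k)`-ball. -/
def DefectClosingAcc : Prop :=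
  ∀ (N : ℕ) (δ ρ K Λ a b cnd η Rw Rb cg θ₀ KA : ℝ), 0 < N → 0 < δ → 0 < ρ → 0 ≤ a → 0 < η → 0 < Rw → 0 < Rb → 0 < cg → 0 < θ₀ →
    ∀ Cs k₀ κ C₂ q₀ : ℝ, ∀ k₀' : ℕ, 0 < k₀ → ∃ q₁ : ℝ, q₀ ≤ q₁ ∧ ∃ k : ℕ, k₀' ≤ k ∧ 1 ≤ k ∧ ∀ Cr : ℝ, ∃ Γ₁ : ℝ, ∀ Γ : ℝ, Γ₁ ≤ Γ →
    ∀ (γ : (Fin N → ℝ) → Fin N → ℝ) (α : (Fin N → ℝ) → ℝ) (X : (Fin N → ℝ) → Fin N → ℝ → EuclideanSpace ℝ (Fin 3)) (w : (Fin N → ℝ) → Fin N → ℝ → ℝ)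
      (c : (Fin N → ℝ) → Fin N → ℝ) (m n : (Fin N → ℝ) → Fin N → EuclideanSpace ℝ (Fin 3)) (Aa : (Fin N → ℝ) → Fin N → ℝ → ℝ)
      (u : (Fin N → ℝ) → (Fin N → ℝ → EuclideanSpace ℝ (Fin 3)) → EuclideanSpace ℝ (Fin 3) → EuclideanSpace ℝ (Fin 3))
      (v : (Fin N → ℝ) → EuclideanSpace ℝ (Fin 3) → EuclideanSpace ℝ (Fin 3)) (A : (Fin N → ℝ) → Fin N → (EuclideanSpace ℝ (Fin 3) →L[ℝ] EuclideanSpace ℝ (Fin 3)))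
      (T : (Fin N → ℝ) → (Fin N → ℝ → EuclideanSpace ℝ (Fin 3)) → Fin N → ℝ → EuclideanSpace ℝ (Fin 3))
      (D : (Fin N → ℝ) → Fin N → EuclideanSpace ℝ (Fin 3) → EuclideanSpace ℝ (Fin 3)),
      BoxDefU1 N Γ γ Aa u → BoxDefV1 N α X u v → BoxDefA1 N X c v A → BoxDefT1 N α u T → BoxDefD1 N X c D →
      BoxClauses1R N Γ δ ρ K Λ a b cnd Rw Rb cg θ₀ KA γ α X w c m n Aa v A T →
      ∀ (α0 : (Fin N → ℝ) → ℝ) (β₀ : ℝ) (U0 : (Fin N → ℝ) → ℝ → EuclideanSpace ℝ (Fin 3) → EuclideanSpace ℝ (Fin 3)) (P0 : (Fin N → ℝ) → ℝ → EuclideanSpace ℝ (Fin 3) → ℝ)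
        (Z : (Fin N → ℝ) → ℝ → EuclideanSpace ℝ (Fin 3) → EuclideanSpace ℝ (Fin 3)) (g : (Fin N → ℝ) → ℝ → ℝ) (G kA : (Fin N → ℝ) → ℝ → Fin N → ℝ)
        (r : (Fin N → ℝ) → ℝ → EuclideanSpace ℝ (Fin 3) → EuclideanSpace ℝ (Fin 3)),
        FamilySpecAcc N Γ ρ η Rw Rb θ₀ k₀ k Cs Cr q₁ α X w c Aa u D α0 β₀ U0 P0 Z g G kA r →
      ∀ (𝓚 : (Fin N → ℝ) → ℝ → (EuclideanSpace ℝ (Fin 3) → EuclideanSpace ℝ (Fin 3)) → EuclideanSpace ℝ (Fin 3) → EuclideanSpace ℝ (Fin 3))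
        (𝓠 : (Fin N → ℝ) → ℝ → (EuclideanSpace ℝ (Fin 3) → EuclideanSpace ℝ (Fin 3)) → EuclideanSpace ℝ (Fin 3) → ℝ)
        (𝓫 : (Fin N → ℝ) → ℝ → (EuclideanSpace ℝ (Fin 3) → EuclideanSpace ℝ (Fin 3)) → ℝ)
        (𝓬 : (Fin N → ℝ) → ℝ → (EuclideanSpace ℝ (Fin 3) → EuclideanSpace ℝ (Fin 3)) → Fin N → ℝ),
        DefectGateSpecAcc N Γ κ C₂ β₀ α0 U0 Z D 𝓚 𝓠 𝓫 𝓬 →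
      ∃ (C₀ M : ℝ) (αo g' : (Fin N → ℝ) → ℝ → ℝ) (B k' : (Fin N → ℝ) → ℝ → Fin N → ℝ) (Zr U : (Fin N → ℝ) → ℝ → EuclideanSpace ℝ (Fin 3) → EuclideanSpace ℝ (Fin 3))
        (P : (Fin N → ℝ) → ℝ → EuclideanSpace ℝ (Fin 3) → ℝ), BoxConclAcc N Γ ρ η Rw k₀ (Cs + 1) X w c Aa u D C₀ M αo g' B k' Zr U P

end Summit.NavierStokesRegularity.NavierStokesRegularity.Theorems.DefectColumnGate

end


/-!
# Route `FilamentSkeletonRss` · ∀-crux `TransverseReduction1AR` (stmt-NavierStokesRegularity-23611) · line `defect_column_gate_1AR` → «A1R-acc»: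
# STUB S3-acc `stub_defectClosingAcc : DefectClosingAcc` — PROVED (S3 ported ONE DIMENSION UP: box × window, `N + 1` multipliers, no IVT)

Helper file (theorems only), `--supports stmt-NavierStokesRegularity-23611 --as helper`; LEAD of 23611, lane ns-filament-21221-p1 g13.  Statement = `DefectClosingAcc` of
the line-side vocabulary `…DefectColumnGateDefsRacc` (v3).  HONEST FRAMING: the closing step of a HYPOTHETICAL filament-type rotating-self-similar blow-up route in its
«reduction modulo accretion modes» form (director-ns dss_120 KEEP-R4 branch; MODEL rung, negative side).  Nothing here bears on Navier–Stokes regularity; the A1R-acc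
items are not filed; `TransverseReduction1AR` is neither proved nor refuted.

Proof (p646026/p646054 one dimension up).  Fix the box, `Cs`, `k₀ > 0`, `κ, C₂, q₀, k₀'`.  Take `q₁ := q₀`, `k := max (max k₀' 1) (⌈2|κ| + |q₀|⌉₊ + 2)`, and for `C_r` the
threshold `Γ₁ := max 1 (64C₂²|C_r| + 4|C₂||C_r| + 4|C₂||C_r|/η + 2)` (`closing_thresholds`; also `Γ·2C₂Γ^κ·C_rΓ^{−k} ≤ 1`, `closing_threshold_export`).  For `Γ ≥ Γ₁`, a
p-family, an S1-acc family (`FamilySpecAcc`) and an S2-acc gate (`DefectGateSpecAcc`): at every `(p, β)` of cube × window the landed Picard iteration gives the fixed point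
`G_{p,β} = −r − D(𝓚G)[𝓚G]` in the `2ε`-ball; the outputs over the ABSTRACT window `b ∈ [−1, 1]` (`β = β₀b`) are `αo := α⁰_p + β₀b`, `U := U⁰ + 𝓚G`, `P := P⁰ + 𝓠G`,
`g' := σ·(g − 𝓫G)`, `Zr := σ·Z` (`σ = ±1` the family's orientation), `B_j := G_j − 𝓬_jG`, `k' := kA`.  Then: the equation holds modulo `g'·Zr + Σ_j B_j·D_pj`
(`E(U⁰+W) + ∇(P⁰+Q) = (r + gZ + ΣG_jD_j) + (G − 𝓫G·Z − Σ𝓬_jG·D_j) + DW[W]`); `(g', B)` is JOINTLY CONTINUOUS on the box — `g, G_j` by the family's local continuity,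
`𝓫G, 𝓬_jG` by `continuousOn_functional_fixedPoint` (p678336) instantiated `N + 1` times on the parameter set `cube ×ˢ [−β₀, β₀] ⊆ (Fin N → ℝ) × ℝ`, then pulled back
along `(p, b) ↦ (p, β₀b)`; the rate faces `g'(p, −1) < 0 < g'(p, 1)` from the family's margins `∓Γ^{−q₁}` and `|𝓫G| < Γ^{−q₁}`; the export law transfers with
`Ce = Cs + 1` since `Γ·|𝓬_jG| ≤ Γ·2C₂C_rΓ^{κ−k} ≤ 1`; `αo ≠ 0`, `U ≠ 0`, decay, pressure and waist envelopes as in `almostConcl_of_balanced`.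
-/

set_option linter.dupNamespace false

noncomputable section

namespace Summit.NavierStokesRegularity.NavierStokesRegularity.Theorems.DefectColumnGate

open scoped BigOperators Topology InnerProductSpace ContDiff
open Filter Set Function MeasureTheory Metric
open Literature.Analysis.FluidPDE
open Summit.NavierStokesRegularity.NavierStokesRegularity.Theses.FilamentSkeletonRss
open Summit.NavierStokesRegularity.NavierStokesRegularity.Theorems.KelvinGate

/-! ## One more threshold: the export transfer -/

/-- For `Γ ≥ 1`, `k ≥ κ + 2` and `Γ ≥ 2|C₂||C_r|`: `Γ · (C₂Γ^κ · 2C_rΓ^{−k}) ≤ 1` (the accretion coefficients of the fixed-point forcing cost at most `1/Γ`). -/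
theorem closing_threshold_export {Γ κ C₂ Cr : ℝ} {k : ℕ} (hΓ1 : 1 ≤ Γ) (hk : κ + 2 ≤ (k:ℝ)) (hΓbig : 2 * |C₂| * |Cr| ≤ Γ) :
    Γ * (C₂ * Γ ^ κ * (2 * (Cr * Γ ^ (-(k:ℝ))))) ≤ 1 := by
  have hΓ0 : 0 < Γ := by linarith
  have e : Γ * (C₂ * Γ ^ κ * (2 * (Cr * Γ ^ (-(k:ℝ))))) = 2 * (C₂ * Cr) * (Γ ^ (1:ℝ) * Γ ^ κ * Γ ^ (-(k:ℝ))) := by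
    rw [Real.rpow_one]; ring
  have e2 : Γ ^ (1:ℝ) * Γ ^ κ * Γ ^ (-(k:ℝ)) = Γ ^ (1 + κ + -(k:ℝ)) := by
    rw [Real.rpow_add hΓ0, Real.rpow_add hΓ0]
  have hexp : Γ ^ (1 + κ + -(k:ℝ)) ≤ Γ⁻¹ := by
    rw [← Real.rpow_neg_one]; exact Real.rpow_le_rpow_of_exponent_le hΓ1 (by linarith)
  have hACr : C₂ * Cr ≤ |C₂| * |Cr| := by rw [← abs_mul]; exact le_abs_self _
  rw [e, e2]
  calc 2 * (C₂ * Cr) * Γ ^ (1 + κ + -(k:ℝ)) ≤ 2 * (|C₂| * |Cr|) * Γ ^ (1 + κ + -(k:ℝ)) :=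
        mul_le_mul_of_nonneg_right (by linarith) (Real.rpow_nonneg hΓ0.le _)
    _ ≤ 2 * (|C₂| * |Cr|) * Γ⁻¹ := mul_le_mul_of_nonneg_left hexp (by positivity)
    _ = (2 * |C₂| * |Cr|) / Γ := by rw [div_eq_mul_inv]; ring
    _ ≤ 1 := by rw [div_le_one hΓ0]; exact hΓbig

/-! ## Conclusion bookkeeping at one parameter: equation MODULO the rate column and the accretion modes -/

/-- **Bookkeeping at one `(p, β)`.**  A smooth divergence-free base `(U⁰, P⁰)` of X-size `CsΓ⁴` with residual `E_a(U⁰) + ∇P⁰ = r + g·Z + Σ_j G_j·D_j`, a bordered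
solve `𝓛W + ∇Q + 𝓫·Z + Σ_j 𝓬_j·D_j = G` with `X(W), |Q| ≤ 2Aε`, and the fixed-point relation `G = −r − DW[W]` give, for any sign `σ` with `σ·σ = 1`:
`E_a(U⁰ + W) + ∇(P⁰ + Q) = (σ(g − 𝓫))·(σZ) + Σ_j (G_j − 𝓬_j)·D_j`, `U⁰ + W ≠ 0` (unit of mass at `y₀` vs `2Aε ≤ ½`), decay `(CsΓ⁴ + 2Aε)/(1+‖y‖)`, pressure bound,
and waist closeness `η√Γ` (from `η√Γ/2 + 2Aε`). -/
theorem boxConcl_point_of_fixedPoint {N : ℕ} {Γ ρ η Rw Cs A ε a : ℝ} {X : Fin N → ℝ → EuclideanSpace ℝ (Fin 3)}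
    {u : (Fin N → ℝ → EuclideanSpace ℝ (Fin 3)) → EuclideanSpace ℝ (Fin 3) → EuclideanSpace ℝ (Fin 3)}
    {U0 W Z r G : EuclideanSpace ℝ (Fin 3) → EuclideanSpace ℝ (Fin 3)} {P0 Q : EuclideanSpace ℝ (Fin 3) → ℝ}
    {D : Fin N → EuclideanSpace ℝ (Fin 3) → EuclideanSpace ℝ (Fin 3)} {g 𝓫 σ : ℝ} {Gc 𝓬 : Fin N → ℝ}
    (hU0s : ContDiff ℝ (⊤:ℕ∞) U0) (hP0s : ContDiff ℝ (⊤:ℕ∞) P0) (hdiv0 : VectorCalculus.IsDivFree U0) (hU0X : XBound U0 (Cs * Γ ^ 4))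
    (hP0b : ∀ y, |P0 y| ≤ Cs * Γ ^ 4) (hy₀ : ∃ y₀, ‖y₀‖ ≤ Cs ∧ 1 ≤ ‖U0 y₀‖)
    (hwaist : ∀ y, ‖y‖ ≤ Rw * √Γ → (∀ j τ, ρ * √Γ / 4 ≤ ‖y - X j τ‖) → ‖U0 y - u X y‖ ≤ η * √Γ / 2)
    (hres : ∀ y, lerayOp a U0 y + gradient P0 y = r y + g • Z y + ∑ j, Gc j • D j y)
    (hW : XBound W (A * (2 * ε))) (hQ1 : ContDiff ℝ 1 Q) (hQb : ∀ y, |Q y| ≤ A * (2 * ε)) (hdivW : VectorCalculus.IsDivFree W)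
    (heq : ∀ y, lerayLin a U0 W y + gradient Q y + 𝓫 • Z y + ∑ j, 𝓬 j • D j y = G y)
    (hfix : ∀ y, G y = -r y - fderiv ℝ W y (W y)) (hσ : σ * σ = 1)
    (hhalf : 2 * A * ε ≤ 1 / 2) (hηΓ : 2 * A * ε ≤ η * √Γ / 2) :
    (fun z => U0 z + W z) ≠ 0 ∧ ContDiff ℝ 2 (fun z => U0 z + W z) ∧ ContDiff ℝ 1 (fun z => P0 z + Q z) ∧ VectorCalculus.IsDivFree (fun z => U0 z + W z) ∧
    (∀ y, lerayOp a (fun z => U0 z + W z) y + gradient (fun z => P0 z + Q z) y = (σ * (g - 𝓫)) • (σ • Z y) + ∑ j, (Gc j - 𝓬 j) • D j y) ∧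
    (∀ y, ‖U0 y + W y‖ ≤ (Cs * Γ ^ 4 + 2 * A * ε) / (1 + ‖y‖)) ∧ (∀ y, |P0 y + Q y| ≤ Cs * Γ ^ 4 + 2 * A * ε) ∧
    (∀ y, ‖y‖ ≤ Rw * √Γ → (∀ j τ, ρ * √Γ / 4 ≤ ‖y - X j τ‖) → ‖U0 y + W y - u X y‖ ≤ η * √Γ) := by
  obtain ⟨y₀, -, hy₀⟩ := hy₀
  have hU02 : ContDiff ℝ 2 U0 := hU0s.of_le (WithTop.coe_le_coe.mpr (le_top : ((2 : ℕ) : ℕ∞) ≤ ⊤))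
  have hP01 : ContDiff ℝ 1 P0 := hP0s.of_le (WithTop.coe_le_coe.mpr (le_top : ((1 : ℕ) : ℕ∞) ≤ ⊤))
  have hWb : ∀ y, ‖W y‖ ≤ 2 * A * ε := fun y => by
    have h1 := (hW.2 y).1
    have h2 : ‖W y‖ ≤ (1 + ‖y‖) * ‖W y‖ := le_mul_of_one_le_left (norm_nonneg _) (by linarith [norm_nonneg y])
    linarith
  refine ⟨?_, hU02.add hW.1, hP01.add hQ1, ?_, fun y => ?_, fun y => ?_, fun y => ?_, fun y hy htube => ?_⟩
  · -- `U ≠ 0`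
    intro hzero
    have h0 : U0 y₀ + W y₀ = 0 := by simpa using congrFun hzero y₀
    have hW0 : ‖W y₀‖ ≤ 1 / 2 := (hWb y₀).trans hhalf
    have : U0 y₀ = -W y₀ := eq_neg_of_add_eq_zero_left h0
    rw [this, norm_neg] at hy₀
    linarith
  · exact isDivFree_add hdiv0 hdivW (hU02.differentiable (by norm_num)) (hW.1.differentiable (by norm_num))
  · -- the profile equation modulo the `N + 1` modes, pointwise
    have hQd : DifferentiableAt ℝ Q y := (hQ1.differentiable (by norm_num)) y
    rw [lerayOp_add_eq a U0 W y hU02.contDiffAt hW.1.contDiffAt, gradient_fun_add' ((hP01.differentiable (by norm_num)) y) hQd]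
    have e : lerayOp a U0 y + lerayLin a U0 W y + fderiv ℝ W y (W y) + (gradient P0 y + gradient Q y) =
        (lerayOp a U0 y + gradient P0 y) + (lerayLin a U0 W y + gradient Q y) + fderiv ℝ W y (W y) := by abel
    have heq' : lerayLin a U0 W y + gradient Q y = G y - 𝓫 • Z y - ∑ j, 𝓬 j • D j y := by
      rw [← heq y]; abel
    have hσσ : (σ * (g - 𝓫)) • (σ • Z y) = (g - 𝓫) • Z y := by
      rw [smul_smul, show σ * (g - 𝓫) * σ = (g - 𝓫) * (σ * σ) by ring, hσ, mul_one]
    rw [e, hres y, heq', hfix y, hσσ, sub_smul]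
    simp only [sub_smul, Finset.sum_sub_distrib]
    abel
  · -- decay
    have hy1 : 0 < 1 + ‖y‖ := by positivity
    rw [le_div_iff₀ hy1]
    have h1 : ‖U0 y‖ * (1 + ‖y‖) ≤ Cs * Γ ^ 4 := by rw [mul_comm]; exact (hU0X.2 y).1
    have h2 : ‖W y‖ * (1 + ‖y‖) ≤ 2 * A * ε := by
      have := (hW.2 y).1; rw [mul_comm] at this; linarith
    calc ‖U0 y + W y‖ * (1 + ‖y‖) ≤ (‖U0 y‖ + ‖W y‖) * (1 + ‖y‖) :=
          mul_le_mul_of_nonneg_right (norm_add_le _ _) hy1.le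
      _ = ‖U0 y‖ * (1 + ‖y‖) + ‖W y‖ * (1 + ‖y‖) := by ring
      _ ≤ Cs * Γ ^ 4 + 2 * A * ε := by linarith
  · calc |P0 y + Q y| ≤ |P0 y| + |Q y| := abs_add_le _ _
      _ ≤ Cs * Γ ^ 4 + 2 * A * ε := by linarith [hP0b y, hQb y]
  · calc ‖U0 y + W y - u X y‖ = ‖(U0 y - u X y) + W y‖ := by abel_nf
      _ ≤ ‖U0 y - u X y‖ + ‖W y‖ := norm_add_le _ _
      _ ≤ η * √Γ / 2 + η * √Γ / 2 := add_le_add (hwaist y hy htube) ((hWb y).trans hηΓ)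
      _ = η * √Γ := by ring

/-! ## Continuity pulled back along the window rescaling -/

/-- Membership bookkeeping for the physical parameter set `cube ×ˢ [−β₀, β₀]`. -/
theorem mem_cubeWindow_iff {N : ℕ} {β₀ : ℝ} (π : (Fin N → ℝ) × ℝ) :
    π ∈ ({p : Fin N → ℝ | ∀ i, p i ∈ Icc (0:ℝ) 1} ×ˢ Icc (-β₀) β₀) ↔ (∀ i, π.1 i ∈ Icc (0:ℝ) 1) ∧ |π.2| ≤ β₀ := by
  rw [mem_prod, mem_setOf_eq, mem_Icc, abs_le]

/-- Product distance bookkeeping: `dist π' π < δ` in `(Fin N → ℝ) × ℝ` gives `dist p' p < δ` and `|β' − β| < δ`. -/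
theorem dist_cubeWindow_lt {N : ℕ} {π π' : (Fin N → ℝ) × ℝ} {δ : ℝ} (h : dist π' π < δ) : dist π'.1 π.1 < δ ∧ |π'.2 - π.2| < δ := by
  rw [Prod.dist_eq, max_lt_iff, Real.dist_eq] at h
  exact h

/-! ## The stub -/

/-- **STUB S3-acc `DefectClosingAcc` OF THE A1R-acc LINE, PROVED** (statement `…DefsRacc.DefectClosingAcc`, by name). -/
theorem stub_defectClosingAcc : DefectClosingAcc := by
  intro N δ ρ K Λ a b cnd η Rw Rb cg θ₀ KA hN hδ hρ ha hη hRw hRb hcg hθ₀ Cs k₀ κ C₂ q₀ k₀' hk₀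
  refine ⟨q₀, le_rfl, max (max k₀' 1) (⌈2 * |κ| + |q₀|⌉₊ + 2), le_trans (le_max_left _ _) (le_max_left _ _),
    le_trans (le_max_right _ _) (le_max_left _ _), ?_⟩
  set k : ℕ := max (max k₀' 1) (⌈2 * |κ| + |q₀|⌉₊ + 2) with hk
  intro Cr
  refine ⟨max 1 (64 * C₂ ^ 2 * |Cr| + 4 * |C₂| * |Cr| + 4 * |C₂| * |Cr| / η + 2), ?_⟩
  intro Γ hΓ γ α X w c m n Aa u v A T D hu hv hA hT hD hcl α0 β₀ U0 P0 Z g Gc kA r hfam 𝓚 𝓠 𝓫 𝓬 hgate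
  classical
  have hΓ1 : 1 ≤ Γ := le_trans (le_max_left _ _) hΓ
  have hΓbig : 64 * C₂ ^ 2 * |Cr| + 4 * |C₂| * |Cr| + 4 * |C₂| * |Cr| / η + 2 ≤ Γ := le_trans (le_max_right _ _) hΓ
  have hΓ0 : 0 < Γ := by linarith
  -- the order `k`
  have hk1 : 1 ≤ k := le_trans (le_max_right _ _) (le_max_left _ _)
  have hkR : 2 * |κ| + |q₀| + 2 ≤ (k:ℝ) := by
    have h1 : ((⌈2 * |κ| + |q₀|⌉₊ + 2 : ℕ) : ℝ) ≤ (k:ℝ) := by exact_mod_cast le_max_right (max k₀' 1) (⌈2 * |κ| + |q₀|⌉₊ + 2)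
    push_cast at h1
    linarith [Nat.le_ceil (2 * |κ| + |q₀|)]
  have hk2κ : 2 * κ + 1 ≤ (k:ℝ) := by linarith [le_abs_self κ, abs_nonneg q₀]
  have hkq : κ - (k:ℝ) + q₀ ≤ -2 := by linarith [le_abs_self κ, le_abs_self q₀, abs_nonneg κ]
  have hkκ2 : κ + 2 ≤ (k:ℝ) := by linarith [le_abs_self κ, abs_nonneg q₀, abs_nonneg κ]
  -- the cube and the family facts
  set cube : Set (Fin N → ℝ) := {p : Fin N → ℝ | ∀ i, p i ∈ Icc (0:ℝ) 1} with hcube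
  obtain ⟨hβ₀, hβθ, -, hsign, hfamp⟩ := id hfam
  obtain ⟨hg12, htight, hgc⟩ := id hgate
  let p₀ : Fin N → ℝ := fun _ => 0
  have hp₀ : ∀ i, p₀ i ∈ Icc (0:ℝ) 1 := fun _ => ⟨le_rfl, zero_le_one⟩
  have habs1 : |(-β₀)| ≤ β₀ := by rw [abs_neg, abs_of_pos hβ₀]
  have habs2 : |β₀| ≤ β₀ := by rw [abs_of_pos hβ₀]
  have hres : ∀ p : Fin N → ℝ, (∀ i, p i ∈ Icc (0:ℝ) 1) → ∀ β : ℝ, |β| ≤ β₀ → YBound (r p β) (Cr * Γ ^ (-(k:ℝ))) :=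
    fun p hp β hβ => ((hfamp p hp).2.1 β hβ).2.2.2.2.2.2.2.2.2.2.1
  have hCr : 0 ≤ Cr := by
    have hε0 : 0 ≤ Cr * Γ ^ (-(k:ℝ)) := (hres p₀ hp₀ β₀ habs2).nonneg
    have hpos : 0 < Γ ^ (-(k:ℝ)) := Real.rpow_pos_of_pos hΓ0 _
    by_contra hneg
    push Not at hneg
    have : Cr * Γ ^ (-(k:ℝ)) < 0 := mul_neg_of_neg_of_pos hneg hpos
    linarith
  obtain ⟨h64, hhalf, hηΓ, hbq⟩ := closing_thresholds hΓ1 hk2κ hk1 hkq hη hCr hΓbig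
  have hexport : Γ * (C₂ * Γ ^ κ * (2 * (Cr * Γ ^ (-(k:ℝ))))) ≤ 1 := by
    have hCrabs : |Cr| = Cr := abs_of_nonneg hCr
    refine closing_threshold_export hΓ1 hkκ2 ?_
    have : 0 ≤ 64 * C₂ ^ 2 * |Cr| := by positivity
    have : 0 ≤ 4 * |C₂| * |Cr| / η := by positivity
    linarith
  set ε : ℝ := Cr * Γ ^ (-(k:ℝ)) with hε
  set Ag : ℝ := C₂ * Γ ^ κ with hAg
  have hε0 : 0 ≤ ε := (hres p₀ hp₀ β₀ habs2).nonneg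
  have h16 : 16 * Ag ^ 2 * ε ≤ 1 := by nlinarith [sq_nonneg Ag]
  have hhalf' : 2 * Ag * ε ≤ 1 / 2 := by rw [hAg, hε]; linarith
  have hηΓ' : 2 * Ag * ε ≤ η * √Γ / 2 := by rw [hAg, hε]; linarith
  -- gate clauses (1) and (2), split
  have hK1 : ∀ p : Fin N → ℝ, (∀ i, p i ∈ Icc (0:ℝ) 1) → ∀ β : ℝ, |β| ≤ β₀ → ∀ (F : EuclideanSpace ℝ (Fin 3) → EuclideanSpace ℝ (Fin 3)) (R : ℝ), YBound F R →
      XBound (𝓚 p β F) (Ag * R) := fun p hp β hβ F R hF => ((hg12 p hp β hβ).1 F R hF).1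
  have hK2 : ∀ p : Fin N → ℝ, (∀ i, p i ∈ Icc (0:ℝ) 1) → ∀ β : ℝ, |β| ≤ β₀ → ∀ (F G : EuclideanSpace ℝ (Fin 3) → EuclideanSpace ℝ (Fin 3)) (s : ℝ), (∃ R, YBound F R) →
      (∃ R, YBound G R) → 𝓚 p β (fun y => F y + s • G y) = fun y => 𝓚 p β F y + s • 𝓚 p β G y :=
    fun p hp β hβ F G s hF hG => ((hg12 p hp β hβ).2 F G s hF hG).1
  have hA0 : 0 ≤ Ag := by
    have h := (hK1 p₀ hp₀ β₀ habs2 (fun _ => 0) 1 (yBound_zero.mono zero_le_one)).nonneg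
    linarith
  -- per-(p,β) frozen Picard
  have hpic : ∀ p : Fin N → ℝ, (∀ i, p i ∈ Icc (0:ℝ) 1) → ∀ β : ℝ, |β| ≤ β₀ → ∃ F : EuclideanSpace ℝ (Fin 3) → EuclideanSpace ℝ (Fin 3),
      YBound F (2 * ε) ∧ ∀ y, F y = -r p β y - fderiv ℝ (𝓚 p β F) y (𝓚 p β F y) :=
    fun p hp β hβ => picard_exists_fixedPoint (K := 𝓚 p β) (A := Ag) (hK1 p hp β hβ) (hK2 p hp β hβ) (hres p hp β hβ) h16
  choose! G hG using hpic
  -- bounds on the multipliers of the fixed-point forcing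
  have hbB : ∀ p : Fin N → ℝ, (∀ i, p i ∈ Icc (0:ℝ) 1) → ∀ β : ℝ, |β| ≤ β₀ → |𝓫 p β (G p β)| ≤ Ag * (2 * ε) :=
    fun p hp β hβ => ((hg12 p hp β hβ).1 (G p β) _ (hG p hp β hβ).1).2.2.2.1
  have hcB : ∀ p : Fin N → ℝ, (∀ i, p i ∈ Icc (0:ℝ) 1) → ∀ β : ℝ, |β| ≤ β₀ → ∀ j, |𝓬 p β (G p β) j| ≤ Ag * (2 * ε) :=
    fun p hp β hβ j => ((hg12 p hp β hβ).1 (G p β) _ (hG p hp β hβ).1).2.2.2.2.1 j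
  have hbq' : ∀ p : Fin N → ℝ, (∀ i, p i ∈ Icc (0:ℝ) 1) → ∀ β : ℝ, |β| ≤ β₀ → |𝓫 p β (G p β)| < Γ ^ (-q₀) :=
    fun p hp β hβ => lt_of_le_of_lt (hbB p hp β hβ) hbq
  -- the orientation sign
  set σ : ℝ := if (∀ p : Fin N → ℝ, (∀ i, p i ∈ Icc (0:ℝ) 1) → g p (-β₀) ≤ -Γ ^ (-q₀) ∧ Γ ^ (-q₀) ≤ g p β₀) then 1 else -1 with hσdef
  have hσ : σ * σ = 1 := by
    rw [hσdef]; split_ifs <;> norm_num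
  -- the window rescaling
  have hwin : ∀ b' : ℝ, b' ∈ Icc (-1:ℝ) 1 → |β₀ * b'| ≤ β₀ := by
    intro b' hb'
    rw [abs_mul, abs_of_pos hβ₀]
    have : |b'| ≤ 1 := abs_le.mpr ⟨hb'.1, hb'.2⟩
    nlinarith
  -- THE OUTPUTS
  refine ⟨Cs * Γ ^ 4 + 2 * Ag * ε, Cs * Γ ^ 4 + 2 * Ag * ε, fun p b' => α0 p + β₀ * b',
    fun p b' => σ * (g p (β₀ * b') - 𝓫 p (β₀ * b') (G p (β₀ * b'))),
    fun p b' j => Gc p (β₀ * b') j - 𝓬 p (β₀ * b') (G p (β₀ * b')) j, fun p b' j => kA p (β₀ * b') j,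
    fun p b' y => σ • Z p (β₀ * b') y, fun p b' y => U0 p (β₀ * b') y + 𝓚 p (β₀ * b') (G p (β₀ * b')) y,
    fun p b' y => P0 p (β₀ * b') y + 𝓠 p (β₀ * b') (G p (β₀ * b')) y, ?_, ?_, ?_⟩
  · /- JOINT CONTINUITY of `(g', B)` on `cube ×ˢ [−1, 1]`: first on the physical parameter set `S = cube ×ˢ [−β₀, β₀]`, then pulled back
       along `(p, b) ↦ (p, β₀b)`. -/
    set S : Set ((Fin N → ℝ) × ℝ) := cube ×ˢ Icc (-β₀) β₀ with hS
    have hSm : ∀ π : (Fin N → ℝ) × ℝ, π ∈ S → (∀ i, π.1 i ∈ Icc (0:ℝ) 1) ∧ |π.2| ≤ β₀ := fun π hπ => (mem_cubeWindow_iff π).mp hπ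
    -- the abstract continuity theorem's hypotheses, on `S`
    have aK1 : ∀ π ∈ S, ∀ (F : EuclideanSpace ℝ (Fin 3) → EuclideanSpace ℝ (Fin 3)) (R : ℝ), YBound F R → XBound (𝓚 π.1 π.2 F) (Ag * R) :=
      fun π hπ => hK1 π.1 (hSm π hπ).1 π.2 (hSm π hπ).2
    have aK2 : ∀ π ∈ S, ∀ (F G : EuclideanSpace ℝ (Fin 3) → EuclideanSpace ℝ (Fin 3)) (s : ℝ), (∃ R, YBound F R) → (∃ R, YBound G R) →
        𝓚 π.1 π.2 (fun y => F y + s • G y) = fun y => 𝓚 π.1 π.2 F y + s • 𝓚 π.1 π.2 G y :=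
      fun π hπ => hK2 π.1 (hSm π hπ).1 π.2 (hSm π hπ).2
    have aK3 : ∀ R L t : ℝ, 0 < t → ∃ L' δ₀ : ℝ, 0 < δ₀ ∧ ∀ π ∈ S, ∀ F : EuclideanSpace ℝ (Fin 3) → EuclideanSpace ℝ (Fin 3),
        YBound F R → (∀ y, ‖y‖ ≤ L' → ‖F y‖ ≤ δ₀) → ∀ y, ‖y‖ ≤ L → ‖𝓚 π.1 π.2 F y‖ ≤ t ∧ ‖fderiv ℝ (𝓚 π.1 π.2 F) y‖ ≤ t := by
      intro R L t ht
      obtain ⟨L', δ₀, hδ₀, h3⟩ := htight R L t ht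
      exact ⟨L', δ₀, hδ₀, fun π hπ F hF hsm => (h3 π.1 (hSm π hπ).1 π.2 (hSm π hπ).2 F hF hsm).1⟩
    have aK4 : ∀ π ∈ S, ∀ (F : EuclideanSpace ℝ (Fin 3) → EuclideanSpace ℝ (Fin 3)) (R L t : ℝ), YBound F R → 0 < t →
        ∃ δ' > 0, ∀ π' ∈ S, dist π' π < δ' → LocClose (𝓚 π'.1 π'.2 F) (𝓚 π.1 π.2 F) L t := by
      intro π hπ F R L t hF ht
      obtain ⟨δ', hδ', h4⟩ := hgc π.1 (hSm π hπ).1 π.2 (hSm π hπ).2 F R L t hF ht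
      exact ⟨δ', hδ', fun π' hπ' hd => (h4 π'.1 (hSm π' hπ').1 π'.2 (hSm π' hπ').2 (dist_cubeWindow_lt hd).1 (dist_cubeWindow_lt hd).2).1⟩
    have ares : ∀ π ∈ S, YBound (r π.1 π.2) ε := fun π hπ => hres π.1 (hSm π hπ).1 π.2 (hSm π hπ).2
    have arc : ∀ π ∈ S, ∀ L t : ℝ, 0 < t → ∃ δ' > 0, ∀ π' ∈ S, dist π' π < δ' → ∀ y, ‖y‖ ≤ L → ‖r π'.1 π'.2 y - r π.1 π.2 y‖ ≤ t := by
      intro π hπ L t ht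
      obtain ⟨δ', hδ', hc⟩ := (hfamp π.1 (hSm π hπ).1).2.2 π.2 (hSm π hπ).2 L t ht
      exact ⟨δ', hδ', fun π' hπ' hd => (hc π'.1 (hSm π' hπ').1 π'.2 (hSm π' hπ').2 (dist_cubeWindow_lt hd).1 (dist_cubeWindow_lt hd).2).2.2.1⟩
    have aG : ∀ π ∈ S, YBound (G π.1 π.2) (2 * ε) ∧ ∀ y, G π.1 π.2 y = -r π.1 π.2 y - fderiv ℝ (𝓚 π.1 π.2 (G π.1 π.2)) y (𝓚 π.1 π.2 (G π.1 π.2) y) :=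
      fun π hπ => hG π.1 (hSm π hπ).1 π.2 (hSm π hπ).2
    -- (i) `π ↦ 𝓫_π G_π` is continuous on `S`
    have hcb : ContinuousOn (fun π : (Fin N → ℝ) × ℝ => 𝓫 π.1 π.2 (G π.1 π.2)) S := by
      refine continuousOn_functional_fixedPoint (S := S) (r := fun π => r π.1 π.2) (𝓚 := fun π => 𝓚 π.1 π.2) (ℓ := fun π => 𝓫 π.1 π.2)
        (G := fun π => G π.1 π.2) aK1 aK2 aK3 aK4 ares arc h16 hA0 ?_ ?_ ?_ ?_ aG
      · exact fun π hπ F R hF => ((hg12 π.1 (hSm π hπ).1 π.2 (hSm π hπ).2).1 F R hF).2.2.2.1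
      · exact fun π hπ F H s hF hH => ((hg12 π.1 (hSm π hπ).1 π.2 (hSm π hπ).2).2 F H s hF hH).2.1
      · intro R t ht
        obtain ⟨L', δ₀, hδ₀, h3⟩ := htight R 0 t ht
        exact ⟨L', δ₀, hδ₀, fun π hπ F hF hsm => (h3 π.1 (hSm π hπ).1 π.2 (hSm π hπ).2 F hF hsm).2.1⟩
      · intro π hπ F R t hF ht
        obtain ⟨δ', hδ', h4⟩ := hgc π.1 (hSm π hπ).1 π.2 (hSm π hπ).2 F R 0 t hF ht
        exact ⟨δ', hδ', fun π' hπ' hd => (h4 π'.1 (hSm π' hπ').1 π'.2 (hSm π' hπ').2 (dist_cubeWindow_lt hd).1 (dist_cubeWindow_lt hd).2).2.1⟩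
    -- (ii) `π ↦ 𝓬_π G_π j` is continuous on `S` for every `j`
    have hcc : ∀ j, ContinuousOn (fun π : (Fin N → ℝ) × ℝ => 𝓬 π.1 π.2 (G π.1 π.2) j) S := by
      intro j
      refine continuousOn_functional_fixedPoint (S := S) (r := fun π => r π.1 π.2) (𝓚 := fun π => 𝓚 π.1 π.2) (ℓ := fun π F => 𝓬 π.1 π.2 F j)
        (G := fun π => G π.1 π.2) aK1 aK2 aK3 aK4 ares arc h16 hA0 ?_ ?_ ?_ ?_ aG
      · exact fun π hπ F R hF => ((hg12 π.1 (hSm π hπ).1 π.2 (hSm π hπ).2).1 F R hF).2.2.2.2.1 j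
      · exact fun π hπ F H s hF hH => ((hg12 π.1 (hSm π hπ).1 π.2 (hSm π hπ).2).2 F H s hF hH).2.2 j
      · intro R t ht
        obtain ⟨L', δ₀, hδ₀, h3⟩ := htight R 0 t ht
        exact ⟨L', δ₀, hδ₀, fun π hπ F hF hsm => (h3 π.1 (hSm π hπ).1 π.2 (hSm π hπ).2 F hF hsm).2.2 j⟩
      · intro π hπ F R t hF ht
        obtain ⟨δ', hδ', h4⟩ := hgc π.1 (hSm π hπ).1 π.2 (hSm π hπ).2 F R 0 t hF ht
        exact ⟨δ', hδ', fun π' hπ' hd => (h4 π'.1 (hSm π' hπ').1 π'.2 (hSm π' hπ').2 (dist_cubeWindow_lt hd).1 (dist_cubeWindow_lt hd).2).2.2 j⟩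
    -- (iii) `g` and `G_j` are continuous on `S` (family's joint local continuity)
    have hcg : ContinuousOn (fun π : (Fin N → ℝ) × ℝ => g π.1 π.2) S := by
      rw [Metric.continuousOn_iff]
      intro π hπ t ht
      obtain ⟨δ', hδ', hc⟩ := (hfamp π.1 (hSm π hπ).1).2.2 π.2 (hSm π hπ).2 0 (t / 2) (by positivity)
      refine ⟨δ', hδ', fun π' hπ' hd => ?_⟩
      have h := (hc π'.1 (hSm π' hπ').1 π'.2 (hSm π' hπ').2 (dist_cubeWindow_lt hd).1 (dist_cubeWindow_lt hd).2).2.2.2.1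
      rw [Real.dist_eq]; linarith
    have hcG : ∀ j, ContinuousOn (fun π : (Fin N → ℝ) × ℝ => Gc π.1 π.2 j) S := by
      intro j
      rw [Metric.continuousOn_iff]
      intro π hπ t ht
      obtain ⟨δ', hδ', hc⟩ := (hfamp π.1 (hSm π hπ).1).2.2 π.2 (hSm π hπ).2 0 (t / 2) (by positivity)
      refine ⟨δ', hδ', fun π' hπ' hd => ?_⟩
      have h := (hc π'.1 (hSm π' hπ').1 π'.2 (hSm π' hπ').2 (dist_cubeWindow_lt hd).1 (dist_cubeWindow_lt hd).2).2.2.2.2 j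
      rw [Real.dist_eq]; linarith
    -- (iv) assemble on `S`, then pull back along the rescaling
    have hΦ : ContinuousOn (fun π : (Fin N → ℝ) × ℝ => (σ * (g π.1 π.2 - 𝓫 π.1 π.2 (G π.1 π.2)),
        fun j => Gc π.1 π.2 j - 𝓬 π.1 π.2 (G π.1 π.2) j)) S :=
      (continuousOn_const.mul (hcg.sub hcb)).prodMk (continuousOn_pi.2 fun j => (hcG j).sub (hcc j))
    have hψ : Continuous fun q : (Fin N → ℝ) × ℝ => ((q.1, β₀ * q.2) : (Fin N → ℝ) × ℝ) :=
      continuous_fst.prodMk (continuous_const.mul continuous_snd)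
    have hψm : MapsTo (fun q : (Fin N → ℝ) × ℝ => ((q.1, β₀ * q.2) : (Fin N → ℝ) × ℝ)) (cube ×ˢ Icc (-1) 1) S := by
      intro q hq
      rw [mem_prod] at hq
      refine (mem_cubeWindow_iff _).mpr ⟨hq.1, hwin q.2 hq.2⟩
    exact hΦ.comp hψ.continuousOn hψm
  · -- RATE FACES
    intro p hp
    have e1 : β₀ * (-1:ℝ) = -β₀ := mul_neg_one β₀
    have e2 : β₀ * (1:ℝ) = β₀ := mul_one β₀
    simp only [e1, e2]
    have hb1 := abs_lt.mp (hbq' p hp (-β₀) habs1)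
    have hb2 := abs_lt.mp (hbq' p hp β₀ habs2)
    by_cases hor : ∀ p : Fin N → ℝ, (∀ i, p i ∈ Icc (0:ℝ) 1) → g p (-β₀) ≤ -Γ ^ (-q₀) ∧ Γ ^ (-q₀) ≤ g p β₀
    · have hσ1 : σ = 1 := by rw [hσdef, if_pos hor]
      obtain ⟨h1, h2⟩ := hor p hp
      rw [hσ1]; constructor <;> linarith
    · have hσ1 : σ = -1 := by rw [hσdef, if_neg hor]
      obtain ⟨h1, h2⟩ := (hsign.resolve_left hor) p hp
      rw [hσ1]; constructor <;> linarith
  · -- THE BLOCK AT EVERY `(p, b)`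
    intro p b' hp hb'
    set β : ℝ := β₀ * b' with hβdef
    have hβ : |β| ≤ β₀ := hwin b' hb'
    obtain ⟨hU0s, hP0s, hdiv0, hU0X, hP0b, hy₀, hwaist, -, -, -, -, -, hexp, hresEq⟩ := (hfamp p hp).2.1 β hβ
    obtain ⟨hW, hQ1, hQb, -, -, hdivW, heq⟩ := (hg12 p hp β hβ).1 (G p β) _ (hG p hp β hβ).1
    -- the rate `αo = α⁰_p + β₀ b` is nonzero
    have hα₁ : α0 p + β ≠ 0 := by
      have hθα : θ₀ ≤ |α p| := (hcl.2 p hp).2.2.2.2.2.2.2.2.2.2.1.1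
      have hα0 : |α0 p - α p| ≤ θ₀ / 4 := (hfamp p hp).1
      intro h0
      have hα0eq : α0 p = -β := eq_neg_of_add_eq_zero_left h0
      have h1 : |α p| ≤ |α p - α0 p| + |α0 p| := by
        calc |α p| = |(α p - α0 p) + α0 p| := by congr 1; ring
          _ ≤ |α p - α0 p| + |α0 p| := abs_add_le _ _
      rw [abs_sub_comm] at h1
      rw [hα0eq, abs_neg] at h1
      rw [hα0eq] at hα0
      linarith [hβ.trans hβθ]
    obtain ⟨hne, hU2, hP1, hdiv, heqn, hdec, hPM, hwin'⟩ :=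
      boxConcl_point_of_fixedPoint (σ := σ) hU0s hP0s hdiv0 hU0X hP0b hy₀ hwaist hresEq hW hQ1 hQb hdivW heq (hG p hp β hβ).2 hσ
        (by rw [hAg, hε] at hhalf'; linarith) (by rw [hAg, hε] at hηΓ'; linarith)
    refine ⟨hα₁, hne, hU2, hP1, hdiv, fun y => heqn y, fun y => ?_, fun y => ?_, hwin', fun j => ⟨(hexp j).1, ?_⟩⟩
    · have := hdec y; rw [hAg, hε] at this ⊢; exact this
    · have := hPM y; rw [hAg, hε] at this ⊢; exact this
    · -- export transfer: `Γ·|B_j − kA_j F⁰| ≤ Γ·|G_j − kA_j F⁰| + Γ·|𝓬_j G| ≤ Cs + 1`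
      have h1 := (hexp j).2
      have h2 : Γ * |𝓬 p β (G p β) j| ≤ 1 :=
        (mul_le_mul_of_nonneg_left (hcB p hp β hβ j) hΓ0.le).trans (by rw [hAg, hε]; exact hexport)
      have htri : |Gc p β j - 𝓬 p β (G p β) j - kA p β j * areaDefect (deriv (w p j) (c p j)) (Aa p j (c p j))| ≤
          |Gc p β j - kA p β j * areaDefect (deriv (w p j) (c p j)) (Aa p j (c p j))| + |𝓬 p β (G p β) j| := by
        rw [show Gc p β j - 𝓬 p β (G p β) j - kA p β j * areaDefect (deriv (w p j) (c p j)) (Aa p j (c p j)) =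
          (Gc p β j - kA p β j * areaDefect (deriv (w p j) (c p j)) (Aa p j (c p j))) - 𝓬 p β (G p β) j by ring]
        exact abs_sub _ _
      calc Γ * |Gc p β j - 𝓬 p β (G p β) j - kA p β j * areaDefect (deriv (w p j) (c p j)) (Aa p j (c p j))|
          ≤ Γ * (|Gc p β j - kA p β j * areaDefect (deriv (w p j) (c p j)) (Aa p j (c p j))| + |𝓬 p β (G p β) j|) :=
            mul_le_mul_of_nonneg_left htri hΓ0.le
        _ = Γ * |Gc p β j - kA p β j * areaDefect (deriv (w p j) (c p j)) (Aa p j (c p j))| + Γ * |𝓬 p β (G p β) j| := by ring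
        _ ≤ Cs + 1 := add_le_add h1 h2

end Summit.NavierStokesRegularity.NavierStokesRegularity.Theorems.DefectColumnGate

end

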